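import Summits.BirchSwinnertonDyer.BirchSwinnertonDyer.Theorems.PrintCFramBottomClassIndexLawFiveLeKummerRadicalCharacter
import HarnessLib

/-!
# Route `PrintCFram`, crux C2 `BottomClassIndexLawFiveLe` (stmt-BirchSwinnertonDyer-20372), line
# `eisenstein-resource-bdp-line`: **THE KUMMER CHARACTER OF AN EIGEN-RADICAL IS EQUIVARIANT** — `κ(θ_γ σ) = κ(σ)^{a(γ̄)·e(γ̄⁻¹)}`
# under the outer action `θ_γ = absGaloisOuterConj ℚ K γ` of `Γ_ℚ` on `Γ_K`, for an `e`-eigen-radical `α` (`σ₀ α = α^{e σ₀} y^p`)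
# (cell `bsd-print-cfram`, width seat `bsd-line-cfram-p1-w7` g4; helper `--supports` 20372; 0 defs, 0 facts, 0 sorry)

HONEST FRAMING. Nothing about BSD is proved here, no stub is closed. Sequel of `…KummerRadicalCharacter.lean` (the character `κ`
of a `p`-th root `β` of `α ∈ K^×`, `K ∋ ζ_p`: open kernel, kills the inertia above `v ∤ pα`). Here the third admissibility
condition of w2 g9's bridge `SelmerCount.exists_characters_natCard_h1Unramified_le` — the conjugation law `heq` — for the
Kummer character of an EIGEN-radical: with `σ₀ ζ = ζ^{a σ₀}` and `σ₀ α = α^{e σ₀} y_{σ₀}^p`,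
`κ(θ_γ σ) = κ(σ)^{a(γ̄) e(γ̄⁻¹)}` (`γ̄ = absGaloisQuot ℚ K γ`), i.e. `κ` is `ā ē⁻¹`-isotypic — the REFLECTION of the radical
character (Kummer pairing equivariance, [Washington1997] §10.2). Tool: `exists_algEquiv_absGaloisOuterConj_smul` — for every
`γ ∈ Γ_ℚ` the automorphism `g = ι γ ι⁻¹` of `K̄` over `ℚ` restricts to `γ̄` on `K` and `(θ_γ σ) • x = g (σ • g⁻¹ x)` (the
computation behind w7 g3's `HerbrandKummer.exists_lift_absGaloisOuterConj_eq`, for every `γ`).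
THEOREMS ONLY; no definition, no named fact, no `sorry`. BSD is not proved by any of this; no summit statement is proved by this seat.
References: [Washington1997] §10.2; [NeukirchANT1999] Ch. IV §1, §3.
-/

set_option autoImplicit false
-- `…BirchSwinnertonDyer.BirchSwinnertonDyer.Theorems…` is the problem's mandated namespace (D-0017).
set_option linter.dupNamespace false

noncomputable section

namespace Summit.BirchSwinnertonDyer.BirchSwinnertonDyer.Theorems.PrintCFram.KummerRadical

open Literature.NumberTheory.NumberFields Literature.NumberTheory.GaloisRepresentations Literature.FieldTheory.Kummer
open NumberField IsDedekindDomain Field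
open scoped nonZeroDivisors Pointwise

/-! ## §4 Equivariance under the outer action of `Γ_ℚ` -/

section Equivariance

variable {K : Type} [Field K] [NumberField K] [IsGalois ℚ K] {p : ℕ} [hp : Fact p.Prime]

/-- **How `θ_γ σ` acts on `K̄`.** For `γ ∈ Γ_ℚ` let `g = ι γ ι⁻¹ ∈ Aut_ℚ(K̄)` (`ι : ℚ̄ ≅ K̄` the tree's pinned
`absClosureEquiv`). Then `(θ_γ σ) • x = g (σ • g⁻¹ x)` for all `σ ∈ Γ_K`, `x ∈ K̄` (`θ_γ = absGaloisOuterConj ℚ K γ`), and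
`g` restricts to `γ̄ = absGaloisQuot ℚ K γ` on `K`. [cite: NeukirchANT1999, Ch. IV §1] -/
theorem exists_algEquiv_absGaloisOuterConj_smul (γ : absoluteGaloisGroup ℚ) :
    ∃ g : AlgebraicClosure K ≃ₐ[ℚ] AlgebraicClosure K,
      (∀ x : K, g (algebraMap K (AlgebraicClosure K) x) = algebraMap K (AlgebraicClosure K) (absGaloisQuot ℚ K γ x)) ∧
      ∀ (σ : absoluteGaloisGroup K) (x : AlgebraicClosure K),
        absGaloisOuterConj ℚ K γ σ • x = g (σ • g.symm x) := by
  set ι : AlgebraicClosure ℚ ≃ₐ[ℚ] AlgebraicClosure K := absClosureEquiv ℚ K with hιdef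
  set g : AlgebraicClosure K ≃ₐ[ℚ] AlgebraicClosure K :=
    ι.symm.trans ((absoluteGaloisGroup.toAlgEquiv ℚ γ).trans ι) with hgdef
  have hg : ∀ y : AlgebraicClosure K, g y = ι (γ • ι.symm y) := fun y => rfl
  have hι : ∀ z : AlgebraicClosure ℚ, ι z = absClosureEmbedding ℚ K z := fun z => rfl
  have hgK : ∀ x : K, g (algebraMap K (AlgebraicClosure K) x) =
      algebraMap K (AlgebraicClosure K) (absGaloisQuot ℚ K γ x) := by
    intro x
    have h1 : ι.symm (algebraMap K (AlgebraicClosure K) x) = absEmbedding ℚ K x := rfl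
    rw [hg, h1, ← absEmbedding_absGaloisQuot_apply, hι, absClosureEmbedding_absEmbedding]
  refine ⟨g, hgK, fun σ x => ?_⟩
  -- the `K`-automorphism `n = g σ g⁻¹`
  have hgsymmK : ∀ y : K, g.symm (algebraMap K (AlgebraicClosure K) y) =
      algebraMap K (AlgebraicClosure K) ((absGaloisQuot ℚ K γ).symm y) := by
    intro y
    rw [AlgEquiv.symm_apply_eq, hgK, AlgEquiv.apply_symm_apply]
  let r : AlgebraicClosure K ≃+* AlgebraicClosure K :=
    (g.symm.toRingEquiv.trans ((absoluteGaloisGroup.toAlgEquiv K σ).toRingEquiv)).trans g.toRingEquiv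
  have hr : ∀ y : AlgebraicClosure K, r y = g ((absoluteGaloisGroup.toAlgEquiv K σ) (g.symm y)) := fun y => rfl
  let n₀ : AlgebraicClosure K ≃ₐ[K] AlgebraicClosure K :=
    AlgEquiv.ofRingEquiv (f := r) (fun y => by
      rw [hr, hgsymmK, AlgEquiv.commutes, ← hgsymmK, AlgEquiv.apply_symm_apply])
  set n : absoluteGaloisGroup K := (absoluteGaloisGroup.toAlgEquiv K).symm n₀ with hndef
  have hn : ∀ y : AlgebraicClosure K, n • y = g (σ • g.symm y) := fun y => rfl
  have hnn' : ∀ y : AlgebraicClosure K, g (σ • y) = n • g y := fun y => by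
    rw [hn, AlgEquiv.symm_apply_apply]
  -- `θ_γ σ = n` (as in `HerbrandKummer.exists_lift_absGaloisOuterConj_eq`)
  have hθ : absGaloisOuterConj ℚ K γ σ = n := by
    apply absGaloisRestrict_injective ℚ K
    rw [absGaloisRestrict_absGaloisOuterConj]
    apply FaithfulSMul.eq_of_smul_eq_smul (α := AlgebraicClosure ℚ)
    intro y
    apply (absClosureEmbedding_bijective ℚ K).1
    rw [absGaloisRestrict_apply_smul, mul_smul, mul_smul]
    have h2 : absClosureEmbedding ℚ K (γ • absGaloisRestrict ℚ K σ • γ⁻¹ • y) =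
        g (absClosureEmbedding ℚ K (absGaloisRestrict ℚ K σ • γ⁻¹ • y)) := by
      rw [hg, ← hι, ← hι, AlgEquiv.symm_apply_apply]
    have h3 : absClosureEmbedding ℚ K (γ⁻¹ • y) = g.symm (absClosureEmbedding ℚ K y) := by
      rw [AlgEquiv.eq_symm_apply, hg, ← hι, ← hι, AlgEquiv.symm_apply_apply, smul_inv_smul]
    rw [h2, absGaloisRestrict_apply_smul, h3, hnn', AlgEquiv.apply_symm_apply]
  rw [hθ, hn]

/-- **The Kummer character of an eigen-radical is equivariant.** `K/ℚ` Galois with a primitive `p`-th root of unity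
`ζ ∈ K`, `σ₀ ζ = ζ^{a σ₀}`; `α ∈ K^×` an `e`-EIGEN-RADICAL: `σ₀ α = α^{e σ₀} y_{σ₀}^p` for all `σ₀ ∈ Gal(K/ℚ)`; `κ` the Kummer
character of a `p`-th root `β` of `α`. Then for all `γ ∈ Γ_ℚ`, `σ ∈ Γ_K`:
**`κ(θ_γ σ) = κ(σ)^{a(γ̄) · e(γ̄⁻¹)}`** (`θ_γ = absGaloisOuterConj ℚ K γ`, `γ̄ = absGaloisQuot ℚ K γ`) — i.e. `κ` is
`ā ē⁻¹`-isotypic: the REFLECTION of the radical character `ē` (Kummer pairing equivariance).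
[cite: Washington1997, §10.2 (proof of Thm. 10.9: the pairing is Galois-equivariant)] [cite: NeukirchANT1999, Ch. IV §3] -/
theorem kummer_character_absGaloisOuterConj {ζ : K} (hζ : IsPrimitiveRoot ζ p) (a : (K ≃ₐ[ℚ] K) → ℕ)
    (ha : ∀ σ₀ : K ≃ₐ[ℚ] K, σ₀ ζ = ζ ^ a σ₀) {α : K} (hα : α ≠ 0) (e : (K ≃ₐ[ℚ] K) → ℕ)
    (hαe : ∀ σ₀ : K ≃ₐ[ℚ] K, ∃ y : K, σ₀ α = α ^ e σ₀ * y ^ p)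
    {β : AlgebraicClosure K} (hβ : β ^ p = algebraMap K (AlgebraicClosure K) α)
    (κ : absoluteGaloisGroup K →* Multiplicative (ZMod p))
    (hκ : ∀ σ : absoluteGaloisGroup K,
      σ • β = algebraMap K (AlgebraicClosure K) ζ ^ ((κ σ).toAdd : ZMod p).val * β)
    (γ : absoluteGaloisGroup ℚ) (σ : absoluteGaloisGroup K) :
    κ (absGaloisOuterConj ℚ K γ σ) = κ σ ^ (a (absGaloisQuot ℚ K γ) * e (absGaloisQuot ℚ K γ)⁻¹) := by
  haveI : NeZero p := ⟨hp.out.ne_zero⟩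
  set σ₀ := absGaloisQuot ℚ K γ with hσ₀
  set ζ' := algebraMap K (AlgebraicClosure K) ζ with hζ'
  have hζ'p : IsPrimitiveRoot ζ' p := hζ.map_of_injective (algebraMap K (AlgebraicClosure K)).injective
  have hβ0 : β ≠ 0 := fun h => by
    rw [h, zero_pow hp.out.ne_zero, eq_comm, map_eq_zero] at hβ; exact hα hβ
  obtain ⟨g, hgK, hgact⟩ := exists_algEquiv_absGaloisOuterConj_smul (K := K) γ
  have hgsymmK : ∀ y : K, g.symm (algebraMap K (AlgebraicClosure K) y) =
      algebraMap K (AlgebraicClosure K) (σ₀⁻¹ y) := by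
    intro y
    rw [AlgEquiv.symm_apply_eq, hgK, ← hσ₀, ← AlgEquiv.mul_apply, mul_inv_cancel, AlgEquiv.one_apply]
  -- `β' = g⁻¹ β` is a `p`-th root of `σ₀⁻¹ α = α^{e'} y^p`
  obtain ⟨y, hy⟩ := hαe σ₀⁻¹
  set e' : ℕ := e σ₀⁻¹ with he'
  have hy0 : y ≠ 0 := by
    intro h0
    rw [h0, zero_pow hp.out.ne_zero, mul_zero, map_eq_zero_iff _ (σ₀⁻¹).injective] at hy
    exact hα hy
  have hβ'p : (g.symm β) ^ p = (β ^ e' * algebraMap K (AlgebraicClosure K) y) ^ p := by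
    rw [← map_pow, hβ, hgsymmK, hy, map_mul, map_pow, map_pow, mul_pow, ← pow_mul, mul_comm e' p, pow_mul, hβ]
  have hne : β ^ e' * algebraMap K (AlgebraicClosure K) y ≠ 0 :=
    mul_ne_zero (pow_ne_zero _ hβ0) ((map_ne_zero_iff _ (algebraMap K (AlgebraicClosure K)).injective).2 hy0)
  obtain ⟨j, -, hj⟩ := exists_eq_pow_mul_of_pow_eq hζ'p hne hβ'p
  -- `σ β' = ζ'^{k e'} β'`
  set k : ℕ := ((κ σ).toAdd : ZMod p).val with hk
  have hσζ : σ • ζ' = ζ' := by rw [hζ', absoluteGaloisGroup.smul_def, AlgEquiv.commutes]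
  have hσy : σ • algebraMap K (AlgebraicClosure K) y = algebraMap K (AlgebraicClosure K) y := by
    rw [absoluteGaloisGroup.smul_def, AlgEquiv.commutes]
  have hσβ' : σ • g.symm β = ζ' ^ (k * e') * g.symm β := by
    rw [hj, smul_mul', smul_mul', smul_pow', smul_pow', hσζ, hσy, hκ σ, ← hk, mul_pow, ← pow_mul]
    ring
  -- `(θ_γ σ) β = g (σ β') = (g ζ')^{k e'} β = ζ'^{a σ₀ k e'} β`
  have hgζ : g ζ' = ζ' ^ a σ₀ := by rw [hζ', hgK, ← hσ₀, ha σ₀, map_pow]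
  have h1 : absGaloisOuterConj ℚ K γ σ • β = ζ' ^ (a σ₀ * (k * e')) * β := by
    rw [hgact, hσβ', map_mul, map_pow, hgζ, AlgEquiv.apply_symm_apply, ← pow_mul]
  -- compare with `hκ`
  have h2 := hκ (absGaloisOuterConj ℚ K γ σ)
  rw [h1] at h2
  have h3 : ζ' ^ (a σ₀ * (k * e')) = ζ' ^ ((κ (absGaloisOuterConj ℚ K γ σ)).toAdd : ZMod p).val :=
    mul_right_cancel₀ hβ0 h2
  have h4 : ((a σ₀ * (k * e') : ℕ) : ZMod p) = ((κ (absGaloisOuterConj ℚ K γ σ)).toAdd : ZMod p) := by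
    rw [(ZMod.natCast_eq_natCast_iff _ _ _).2 (modEq_of_pow_eq_pow hζ'p h3), ZMod.natCast_zmod_val]
  rw [← ofAdd_toAdd (κ (absGaloisOuterConj ℚ K γ σ)), ← h4, ← ofAdd_toAdd (κ σ), ← ofAdd_nsmul]
  congr 1
  rw [hk, nsmul_eq_mul, Nat.cast_mul, Nat.cast_mul, Nat.cast_mul, ZMod.natCast_zmod_val]
  ring

end Equivariance

end Summit.BirchSwinnertonDyer.BirchSwinnertonDyer.Theorems.PrintCFram.KummerRadical

end
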